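import Summits.Schanuel.Schanuel.Theorems.RootDecomp1KSumFormBridge05

/-!
# RootDecomp1KSumFormBridge — lens 1, generation 41 «SUM-FORM BRIDGE»: the NAMED E-side input `SumFormExpPairMeasure` (CONJECTURE / IDEA-NEEDED, Mahler's problem in sum form) ⟹ a.i. (ℓ, e^ℓ) for every real Liouville ℓ ⟹ 33364's named first open cell (ℓ_b, ℓ_b²) — a REDUCTION (K-R27′), no cell credit — EDITION 2 (+ §9 the door (T⁺⁺) as a typed SOCKET) — continuation (RootDecomp1KSumFormBridge06): §9 (2/2) the graded bridge at ℓ_b: `algebraicIndependent_liouvilleNumber_exp_of_graded`, SOCKET `liouvilleNumber_sq_cell_of_graded`, `growth_of_bounded`, `growth_loglog`, `liouvilleNumber_sq_cell_of_graded_loglog`, `namedCell_socket_summary`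

(lens-1 g41 `RootDecomp1KSumFormBridge.lean` EDITION 2 [HOME/decomp-schanuel-lens-1/g41/ sha256 f8db09bf…, 1674 l; NODE L1914 / REQUEST L1915 / EDITION 2 NOTE L1923; critic VERDICT L1925 (REDUCTION of record, (ε) booking, no credit, port GO)]; port by census-1 gen 17 as
`RootDecomp1KSumFormBridge01`–`06` — see the PORT NOTE of part 01; `--supports stmt-Schanuel-33364`; a REDUCTION to an OPEN conjecture (K-R27′); rung 0.)
-/

noncomputable section

open Complex Polynomial Filter
open scoped Topology

namespace Summit.Schanuel.Schanuel.Theorems.RootDecomp1KSumFormBridge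

open Summit.Schanuel.Schanuel.Theorems.RootDecomp1KHyper
open Summit.Schanuel.Schanuel.Theorems.RootDecomp1KHyper.HyperCell
open Summit.Schanuel.Schanuel.Theorems.RootDecomp1KGeneric
open Literature.NumberTheory.Transcendental (NesterenkoWaldschmidt1996_thm_1 weilHeight₁)

variable {K : ℕ}

/-- **The convergents of `ℓ_b`** (Mathlib `LiouvilleNumber.partialSum_eq_rat`, `remainder_lt`): for every
`k` a fraction `r` with `r.den ≤ b^{k!}`, `ℓ_b ≠ r` and `|ℓ_b − r| < (b^{k!})^{−k} = exp(−k·k!·log b)`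
— approximation exponent `k` at the scale `log q ≤ k!·log b` (`k ≍ log log q / log log log q`). -/
theorem liouvilleNumber_convergent {b : ℕ} (hb : 2 ≤ b) (k : ℕ) :
    ∃ r : ℚ, r.den ≤ b ^ k.factorial ∧ (liouvilleNumber b : ℝ) ≠ r ∧
      |liouvilleNumber b - r| < Real.exp (-((k : ℝ) * ((k.factorial : ℝ) * Real.log b))) := by
  have hb0 : 0 < b := by omega
  have hbR1 : (1 : ℝ) < b := by exact_mod_cast (by omega : 1 < b)
  have hbR2 : (2 : ℝ) ≤ b := by exact_mod_cast hb
  have hbpos : (0 : ℝ) < b := by linarith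
  obtain ⟨p, hp⟩ := LiouvilleNumber.partialSum_eq_rat hb0 k
  rw [Nat.cast_pow] at hp
  set q : ℕ := b ^ k.factorial with hq
  have hq0 : 0 < q := by positivity
  have hcast : ((((p : ℚ) / (q : ℚ)) : ℚ) : ℝ) = LiouvilleNumber.partialSum (b : ℝ) k := by
    rw [hp, hq]; push_cast; ring
  have hrem := LiouvilleNumber.partialSum_add_remainder hbR1 k
  have hRpos := LiouvilleNumber.remainder_pos hbR1 k
  have hRlt := LiouvilleNumber.remainder_lt k hbR2
  refine ⟨(p : ℚ) / (q : ℚ), ?_, ?_, ?_⟩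
  · have h1 : ((p : ℚ) / (q : ℚ)) = Rat.divInt (p : ℤ) (q : ℤ) := by
      rw [Rat.divInt_eq_div]; push_cast; rfl
    have h2 := Rat.den_dvd (p : ℤ) (q : ℤ)
    rw [← h1] at h2
    have h3 : ((p : ℚ) / (q : ℚ)).den ∣ q := by exact_mod_cast h2
    exact Nat.le_of_dvd hq0 h3
  · rw [hcast, ← hrem]; linarith
  · have hdiff : liouvilleNumber b - ((((p : ℚ) / (q : ℚ)) : ℚ) : ℝ) =
        LiouvilleNumber.remainder (b : ℝ) k := by rw [hcast, ← hrem]; ring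
    rw [hdiff, abs_of_pos hRpos]
    refine hRlt.trans_le (le_of_eq ?_)
    rw [Real.exp_neg, Real.exp_nat_mul, Real.exp_nat_mul, Real.exp_log hbpos, one_div]

set_option maxHeartbeats 800000 in
/-- **THE DOOR (T⁺⁺) AS A TYPED SOCKET.**  Let `g` be any rung of the graded axis, non-negative and
monotone on `[1, ∞)`, which along the convergent scales `Λ_k = k!·log b` of `ℓ_b` is infinitely often
below the inverse factorial: `∀ C, ∀ c > 0, ∀ k₀, ∃ k ≥ k₀, C·(1 + g(1 + c·Λ_k)) ≤ k` (every
`g(L) = o(log L / log log L)` qualifies; `g = log` does not).  Then the graded measure with exponent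
`κ·L·g(L)` makes `ℓ_b, e^{ℓ_b}` algebraically independent.  PROOF = the one-shot core at the `k`-th
convergent (`Ψ = k·Λ_k`, `E = (k − D − 2)Λ_k/K`) against the measure at height `≤ 1 + c'Λ_k`.
A PROVED rung plugs in here by `exact`; today only bounded `g` is proved-or-assumed (§8). -/
theorem algebraicIndependent_liouvilleNumber_exp_of_graded {g : ℝ → ℝ} (hG : GradedExpPairMeasure g)
    (hg0 : ∀ L, 1 ≤ L → 0 ≤ g L) (hgm : ∀ L L', 1 ≤ L → L ≤ L' → g L ≤ g L') {b : ℕ} (hb : 2 ≤ b)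
    (hgrow : ∀ C c : ℝ, 0 < c → ∀ k₀ : ℕ, ∃ k : ℕ, k₀ ≤ k ∧
      C * (1 + g (1 + c * ((k.factorial : ℝ) * Real.log b))) ≤ k) :
    AlgebraicIndependent ℚ ![((liouvilleNumber b : ℝ) : ℂ), cexp ((liouvilleNumber b : ℝ) : ℂ)] := by
  by_contra hdep
  have hbR1 : (1 : ℝ) < b := by exact_mod_cast (by omega : 1 < b)
  have hlogb : 0 < Real.log b := Real.log_pos hbR1
  have hlogb2 : Real.log 2 ≤ Real.log b := Real.log_le_log (by norm_num) (by exact_mod_cast hb)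
  have hℓL : Liouville (liouvilleNumber b) := liouville_liouvilleNumber hb
  have hℓt : Transcendental ℚ ((liouvilleNumber b : ℝ) : ℂ) := transcendental_ofReal_of_liouville hℓL
  obtain ⟨N₀, c, K, D, i₀, hK, hc0, hcore⟩ := pairApprox_core_real hℓt hdep
  obtain ⟨κ, hκ⟩ := hG ‖((liouvilleNumber b : ℝ) : ℂ)‖ N₀
  obtain ⟨c', hc'1, hcc'⟩ : ∃ c' : ℝ, 1 ≤ c' ∧ c ≤ c' := ⟨max c 1, le_max_right _ _, le_max_left _ _⟩
  have hc'0 : 0 < c' := by linarith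
  obtain ⟨κ', hκ'0, hκκ'⟩ : ∃ κ' : ℝ, 0 ≤ κ' ∧ κ ≤ κ' := ⟨max κ 0, le_max_right _ _, le_max_left _ _⟩
  -- fractions near `ℓ_b` have large reduced denominators
  obtain ⟨ε, hε0, hεden⟩ := exists_eps_den_gt hℓL.irrational (i₀ + 3)
  obtain ⟨k₁, hk₁⟩ : ∃ k₁ : ℕ, Real.exp (-(k₁ : ℝ) * Real.log 2) < ε := by
    obtain ⟨n, hn⟩ := exists_pow_lt_of_lt_one hε0 (by norm_num : (1 / 2 : ℝ) < 1)
    refine ⟨n, ?_⟩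
    have : Real.exp (-(n : ℝ) * Real.log 2) = (1 / 2 : ℝ) ^ n := by
      rw [neg_mul, Real.exp_neg, Real.exp_nat_mul, Real.exp_log (by norm_num), one_div, inv_pow]
    rw [this]; exact hn
  -- the growth hypothesis with `C := K κ'(1 + c') + K + D + 3`
  have hKr1 : (1 : ℝ) ≤ K := by exact_mod_cast hK
  have hKpos : (0 : ℝ) < K := by linarith
  have hD0 : (0 : ℝ) ≤ D := Nat.cast_nonneg D
  have hC0 : 0 ≤ (K : ℝ) * (κ' * (1 + c')) := by positivity
  obtain ⟨k, hkk₀, hkC⟩ := hgrow ((K : ℝ) * (κ' * (1 + c')) + K + D + 3) c' hc'0 (max k₁ 2)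
  have hk₁k : k₁ ≤ k := le_trans (le_max_left _ _) hkk₀
  have hk2 : 2 ≤ k := le_trans (le_max_right _ _) hkk₀
  -- the convergent
  obtain ⟨r, hrden, hne, hlt⟩ := liouvilleNumber_convergent hb k
  have hfac2 : (2 : ℝ) ≤ k.factorial := by
    exact_mod_cast le_trans hk2 (Nat.self_le_factorial k)
  have hrdenR : (r.den : ℝ) ≤ (b : ℝ) ^ k.factorial := by exact_mod_cast hrden
  generalize hΛ : ((k.factorial : ℝ) * Real.log b) = Λ at hkC hlt
  have hΛ2 : 2 * Real.log b ≤ Λ := by rw [← hΛ]; exact mul_le_mul_of_nonneg_right hfac2 hlogb.le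
  have hΛ1 : 1 ≤ Λ := by linarith [Real.log_two_gt_d9]
  have hΛlog2 : Real.log 2 ≤ Λ := by linarith
  have hΛpos : 0 < Λ := by linarith
  have hx1 : 1 ≤ 1 + c' * Λ := by
    have := mul_pos hc'0 hΛpos
    linarith
  have hgΛ : 0 ≤ g (1 + c' * Λ) := hg0 _ hx1
  -- unpack `C (1 + g) ≤ k`
  have hkC' : (K : ℝ) * (κ' * (1 + c')) * g (1 + c' * Λ) + K + D + 3 ≤ k := by
    have h1 : (K : ℝ) * (κ' * (1 + c')) * g (1 + c' * Λ) ≤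
        ((K : ℝ) * (κ' * (1 + c')) + K + D + 3) * g (1 + c' * Λ) := by
      apply mul_le_mul_of_nonneg_right _ hgΛ
      linarith
    have e : ((K : ℝ) * (κ' * (1 + c')) + K + D + 3) * (1 + g (1 + c' * Λ)) =
        ((K : ℝ) * (κ' * (1 + c')) + K + D + 3) +
          ((K : ℝ) * (κ' * (1 + c')) + K + D + 3) * g (1 + c' * Λ) := by ring
    rw [e] at hkC
    linarith
  have hkD : (D : ℝ) + 2 + K ≤ k := by
    have : (0:ℝ) ≤ (K : ℝ) * (κ' * (1 + c')) * g (1 + c' * Λ) := mul_nonneg hC0 hgΛ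
    linarith
  -- `log r.den ≤ Λ`
  have hq0r : (0 : ℝ) < r.den := by exact_mod_cast r.den_pos
  have hlogq : Real.log r.den ≤ Λ := by
    have h1 : Real.log r.den ≤ Real.log ((b : ℝ) ^ k.factorial) := Real.log_le_log hq0r hrdenR
    rw [Real.log_pow] at h1
    rw [← hΛ]; exact h1
  have hlogq0 : 0 ≤ Real.log r.den := Real.log_natCast_nonneg _
  -- `r.den > i₀ + 3`: `|ℓ_b − r| < exp(−k Λ) ≤ exp(−k₁ log 2) < ε`
  have hdist_small : |liouvilleNumber b - r| < ε := by
    refine hlt.trans_le (le_trans ?_ hk₁.le)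
    rw [Real.exp_le_exp]
    have h0 : (k₁ : ℝ) ≤ k := by exact_mod_cast hk₁k
    have h2 : (0:ℝ) ≤ k₁ := Nat.cast_nonneg _
    have h3 : (k₁ : ℝ) * Real.log 2 ≤ (k : ℝ) * Real.log 2 :=
      mul_le_mul_of_nonneg_right h0 (by linarith [Real.log_two_gt_d9])
    have h4 : (k : ℝ) * Real.log 2 ≤ (k : ℝ) * Λ := mul_le_mul_of_nonneg_left hΛlog2 (Nat.cast_nonneg k)
    linarith
  have hden : i₀ + 3 < r.den := hεden r hdist_small
  -- apply the core with `Ψ := k Λ`, `E := (k − D − 2) Λ / K`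
  obtain ⟨E, hE⟩ : ∃ E : ℝ, E = (((k : ℝ) - D - 2) * Λ) / K := ⟨_, rfl⟩
  have hKE : (K : ℝ) * E = ((k : ℝ) - D - 2) * Λ := by
    rw [hE]; field_simp
  have hEΛ : Λ ≤ E := by
    rw [hE, le_div_iff₀ hKpos]
    have := mul_le_mul_of_nonneg_left hkD hΛpos.le
    linarith
  have hElog : Real.log r.den ≤ E := hlogq.trans hEΛ
  have hΨ : (K : ℝ) * E + ((D : ℝ) + 2) * Real.log r.den ≤ (k : ℝ) * Λ := by
    rw [hKE]
    have : ((D : ℝ) + 2) * Real.log r.den ≤ ((D : ℝ) + 2) * Λ :=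
      mul_le_mul_of_nonneg_left hlogq (by linarith)
    linarith
  obtain ⟨f, S, α, β, hfirr, hfdeg, hS0, hβf, hαS, hα0, hβ0, hdeg, hMS, hMf, hdist⟩ :=
    hcore r ((k : ℝ) * Λ) E (by omega) hlt hΨ hElog
  clear hcore
  -- the measure at height `L' := 1 + c' log q`
  obtain ⟨hαalg, hβalg, hD1, hDle, hhα, hhβ⟩ := pair_bounds f hfirr hfdeg hβf S hS0 hαS
  obtain ⟨L', hL'⟩ : ∃ L' : ℝ, L' = 1 + c' * Real.log r.den := ⟨_, rfl⟩
  have hcL0 : 0 ≤ c' * Real.log r.den := mul_nonneg hc'0.le hlogq0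
  have hL'1 : 1 ≤ L' := by rw [hL']; linarith
  have hcl : c * Real.log r.den ≤ c' * Real.log r.den := mul_le_mul_of_nonneg_right hcc' hlogq0
  have hdata : AlgPairData α β N₀ L' :=
    ⟨hα0, hβ0, hαalg, hβalg, hDle.trans hdeg, hL'1, by rw [hL']; linarith, by rw [hL']; linarith⟩
  have hu0 : ((liouvilleNumber b : ℝ) : ℂ) ≠ 0 :=
    Complex.ofReal_ne_zero.mpr hℓL.irrational.ne_zero
  have hlow := hκ _ α β L' le_rfl hu0 hdata
  -- compare exponents: `κ L' g(L') ≤ κ'(1+c') Λ g(1 + c'Λ) ≤ E`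
  have hL'le : L' ≤ 1 + c' * Λ := by
    have := mul_le_mul_of_nonneg_left hlogq hc'0.le
    rw [hL']; linarith
  have hgL' : g L' ≤ g (1 + c' * Λ) := hgm _ _ hL'1 hL'le
  have hgL'0 : 0 ≤ g L' := hg0 _ hL'1
  have hL'Λ : L' ≤ (1 + c') * Λ := by nlinarith
  have hexp1 : κ * L' * g L' ≤ κ' * ((1 + c') * Λ) * g (1 + c' * Λ) := by
    have a1 : κ * L' * g L' ≤ κ' * L' * g L' :=
      mul_le_mul_of_nonneg_right (mul_le_mul_of_nonneg_right hκκ' (by linarith)) hgL'0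
    have a2 : κ' * L' * g L' ≤ κ' * ((1 + c') * Λ) * g L' :=
      mul_le_mul_of_nonneg_right (mul_le_mul_of_nonneg_left hL'Λ hκ'0) hgL'0
    have a3 : κ' * ((1 + c') * Λ) * g L' ≤ κ' * ((1 + c') * Λ) * g (1 + c' * Λ) :=
      mul_le_mul_of_nonneg_left hgL' (by positivity)
    linarith
  have hexp2 : κ' * ((1 + c') * Λ) * g (1 + c' * Λ) ≤ E := by
    rw [hE, le_div_iff₀ hKpos]
    have h1 : (K : ℝ) * (κ' * (1 + c')) * g (1 + c' * Λ) ≤ (k : ℝ) - D - 2 := by linarith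
    have h2 := mul_le_mul_of_nonneg_right h1 hΛpos.le
    have e : κ' * ((1 + c') * Λ) * g (1 + c' * Λ) * K =
        (K : ℝ) * (κ' * (1 + c')) * g (1 + c' * Λ) * Λ := by ring
    rw [e]; exact h2
  have hfin : Real.exp (-E) ≤ Real.exp (-(κ * L' * g L')) := by
    rw [Real.exp_le_exp]; linarith
  linarith [hdist.trans_le hfin]

/-- **The named cell through the socket.** -/
theorem liouvilleNumber_sq_cell_of_graded {g : ℝ → ℝ} (hG : GradedExpPairMeasure g)
    (hg0 : ∀ L, 1 ≤ L → 0 ≤ g L) (hgm : ∀ L L', 1 ≤ L → L ≤ L' → g L ≤ g L') {b : ℕ} (hb : 2 ≤ b)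
    (hgrow : ∀ C c : ℝ, 0 < c → ∀ k₀ : ℕ, ∃ k : ℕ, k₀ ≤ k ∧
      C * (1 + g (1 + c * ((k.factorial : ℝ) * Real.log b))) ≤ k) :
    SB 2 ![((liouvilleNumber b : ℝ) : ℂ), ((liouvilleNumber b : ℝ) : ℂ) ^ 2] :=
  sb_liouvilleNumber_sq_of_algebraicIndependent
    (algebraicIndependent_liouvilleNumber_exp_of_graded hG hg0 hgm hb hgrow)

/-- Sanity of the socket: every BOUNDED non-negative rung satisfies the growth condition
(so §8's `namedCell_axis` factors through the socket). -/
theorem growth_of_bounded {g : ℝ → ℝ} {G : ℝ} (hG : ∀ L, 1 ≤ L → g L ≤ G)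
    (hg0 : ∀ L, 1 ≤ L → 0 ≤ g L) {b : ℕ} (hb : 2 ≤ b) :
    ∀ C c : ℝ, 0 < c → ∀ k₀ : ℕ, ∃ k : ℕ, k₀ ≤ k ∧
      C * (1 + g (1 + c * ((k.factorial : ℝ) * Real.log b))) ≤ k := by
  intro C c hc k₀
  have hbR1 : (1 : ℝ) < b := by exact_mod_cast (by omega : 1 < b)
  have hlogb : 0 < Real.log b := Real.log_pos hbR1
  refine ⟨max k₀ ⌈|C| * (1 + G)⌉₊, le_max_left _ _, ?_⟩
  set k := max k₀ ⌈|C| * (1 + G)⌉₊ with hk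
  set x : ℝ := 1 + c * ((k.factorial : ℝ) * Real.log b) with hx
  have h1 : 1 ≤ x := by
    have : 0 ≤ c * ((k.factorial : ℝ) * Real.log b) := by positivity
    linarith
  have hgx0 := hg0 x h1
  have hgxG := hG x h1
  have h3 : (⌈|C| * (1 + G)⌉₊ : ℝ) ≤ k := by exact_mod_cast le_max_right k₀ _
  have h4 : |C| * (1 + G) ≤ k := (Nat.le_ceil _).trans h3
  have h5 : C * (1 + g x) ≤ |C| * (1 + G) := by
    calc C * (1 + g x) ≤ |C| * (1 + g x) := mul_le_mul_of_nonneg_right (le_abs_self C) (by linarith)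
      _ ≤ |C| * (1 + G) := mul_le_mul_of_nonneg_left (by linarith) (abs_nonneg C)
  linarith

/-- §8's bounded case re-derived THROUGH the socket (the socket hypothesis is satisfiable). -/
theorem liouvilleNumber_sq_cell_of_graded_bounded {g : ℝ → ℝ} {G : ℝ} (hG : GradedExpPairMeasure g)
    (hgG : ∀ L, 1 ≤ L → g L ≤ G) (hg0 : ∀ L, 1 ≤ L → 0 ≤ g L)
    (hgm : ∀ L L', 1 ≤ L → L ≤ L' → g L ≤ g L') {b : ℕ} (hb : 2 ≤ b) :
    SB 2 ![((liouvilleNumber b : ℝ) : ℂ), ((liouvilleNumber b : ℝ) : ℂ) ^ 2] :=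
  liouvilleNumber_sq_cell_of_graded hG hg0 hgm hb (growth_of_bounded hgG hg0 hb)

/-- **An UNBOUNDED rung satisfies the socket's growth condition: `g(L) = log(1 + log L)`**
(`k! ≤ k^k`, `log x ≤ x − 1`, `log k ≤ 2√k`). -/
theorem growth_loglog {b : ℕ} (hb : 2 ≤ b) :
    ∀ C c : ℝ, 0 < c → ∀ k₀ : ℕ, ∃ k : ℕ, k₀ ≤ k ∧
      C * (1 + Real.log (1 + Real.log (1 + c * ((k.factorial : ℝ) * Real.log b)))) ≤ k := by
  intro C c hc k₀
  have hbR1 : (1 : ℝ) < b := by exact_mod_cast (by omega : 1 < b)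
  have hlogb : 0 < Real.log b := Real.log_pos hbR1
  obtain ⟨M, hM⟩ : ∃ M : ℝ, M = 1 + c * Real.log b := ⟨_, rfl⟩
  have hcb : 0 < c * Real.log b := mul_pos hc hlogb
  have hM1 : 1 ≤ M := by rw [hM]; linarith
  have hlog1M : 0 ≤ Real.log (1 + M) := Real.log_nonneg (by linarith)
  have hCa : 0 ≤ |C| := abs_nonneg C
  obtain ⟨S, hS⟩ : ∃ S : ℝ, S = 4 * |C| + 1 + |C| * (1 + Real.log (1 + M)) := ⟨_, rfl⟩
  have hCM : 0 ≤ |C| * (1 + Real.log (1 + M)) := by positivity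
  have hS1 : 1 ≤ S := by rw [hS]; linarith
  refine ⟨max k₀ (max 1 ⌈S ^ 2⌉₊), le_max_left _ _, ?_⟩
  generalize hk : max k₀ (max 1 ⌈S ^ 2⌉₊) = k
  have hk1 : 1 ≤ k := by rw [← hk]; exact le_trans (le_max_left _ _) (le_max_right _ _)
  have hkS : S ^ 2 ≤ k := by
    refine (Nat.le_ceil _).trans ?_
    rw [← hk]; exact_mod_cast le_trans (le_max_right _ _) (le_max_right _ _)
  have hk1r : (1 : ℝ) ≤ k := by exact_mod_cast hk1
  have hk0r : (0 : ℝ) < k := by linarith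
  -- `X := 1 + c k! log b ≤ (M k)^k`
  have hfac : (k.factorial : ℝ) ≤ (k : ℝ) ^ k := by exact_mod_cast Nat.factorial_le_pow k
  generalize hX : 1 + c * ((k.factorial : ℝ) * Real.log b) = X
  have hfac1 : (1 : ℝ) ≤ k.factorial := by exact_mod_cast Nat.succ_le_of_lt (Nat.factorial_pos k)
  have hX1 : 1 ≤ X := by
    rw [← hX]
    have : 0 ≤ c * ((k.factorial : ℝ) * Real.log b) := by positivity
    linarith
  have hkk1 : (1 : ℝ) ≤ (k : ℝ) ^ k := one_le_pow₀ hk1r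
  have hXle : X ≤ (M * k) ^ k := by
    rw [mul_pow]
    have h1 : X ≤ M * (k : ℝ) ^ k := by
      rw [← hX, hM]
      have := mul_le_mul_of_nonneg_left hfac hcb.le
      nlinarith
    have h2 : M ≤ M ^ k := le_self_pow₀ hM1 (by omega)
    calc X ≤ M * (k : ℝ) ^ k := h1
      _ ≤ M ^ k * (k : ℝ) ^ k := mul_le_mul_of_nonneg_right h2 (by positivity)
  have hMk : 1 ≤ M * k := by nlinarith
  have hlogX : Real.log X ≤ k * (M * k) := by
    calc Real.log X ≤ Real.log ((M * k) ^ k) := Real.log_le_log (by linarith) hXle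
      _ = k * Real.log (M * k) := by rw [Real.log_pow]
      _ ≤ k * (M * k) :=
          mul_le_mul_of_nonneg_left ((Real.log_le_sub_one_of_pos (by linarith)).trans (by linarith))
            hk0r.le
  have hlogX0 : 0 ≤ Real.log X := Real.log_nonneg hX1
  -- `log (1 + log X) ≤ log ((1 + M) k²) = log (1 + M) + 2 log k`
  have hg : Real.log (1 + Real.log X) ≤ Real.log (1 + M) + 2 * Real.log k := by
    have h1 : 1 + Real.log X ≤ (1 + M) * (k : ℝ) ^ 2 := by nlinarith
    calc Real.log (1 + Real.log X) ≤ Real.log ((1 + M) * (k : ℝ) ^ 2) :=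
          Real.log_le_log (by linarith) h1
      _ = Real.log (1 + M) + 2 * Real.log k := by
          rw [Real.log_mul (by linarith) (by positivity), Real.log_pow]; push_cast; ring
  -- `log k ≤ 2 √k` and `S ≤ √k`
  have hs0 : 0 < Real.sqrt k := Real.sqrt_pos.mpr hk0r
  have hsqrt : Real.log k ≤ 2 * Real.sqrt k := by
    have h1 : Real.log (Real.sqrt k) ≤ Real.sqrt k - 1 := Real.log_le_sub_one_of_pos hs0
    have h2 : Real.log (Real.sqrt k) = Real.log k / 2 := Real.log_sqrt hk0r.le
    rw [h2] at h1; linarith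
  have hSk : S ≤ Real.sqrt k := by
    rw [show S = Real.sqrt (S ^ 2) from (Real.sqrt_sq (by linarith)).symm]
    exact Real.sqrt_le_sqrt hkS
  have hsk : Real.sqrt k * Real.sqrt k = k := Real.mul_self_sqrt hk0r.le
  have hs1 : 1 ≤ Real.sqrt k := le_trans hS1 hSk
  -- conclude
  have hgoal : C * (1 + Real.log (1 + Real.log X)) ≤
      |C| * (1 + Real.log (1 + M)) + 4 * |C| * Real.sqrt k := by
    have h0 : 0 ≤ 1 + Real.log (1 + Real.log X) := by
      have : 0 ≤ Real.log (1 + Real.log X) := Real.log_nonneg (by linarith)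
      linarith
    calc C * (1 + Real.log (1 + Real.log X))
        ≤ |C| * (1 + Real.log (1 + Real.log X)) := mul_le_mul_of_nonneg_right (le_abs_self C) h0
      _ ≤ |C| * (1 + Real.log (1 + M) + 2 * (2 * Real.sqrt k)) := by
          apply mul_le_mul_of_nonneg_left _ hCa; linarith
      _ = |C| * (1 + Real.log (1 + M)) + 4 * |C| * Real.sqrt k := by ring
  have hfinal : |C| * (1 + Real.log (1 + M)) + 4 * |C| * Real.sqrt k ≤ k := by
    have h1 : S * Real.sqrt k ≤ k :=
      calc S * Real.sqrt k ≤ Real.sqrt k * Real.sqrt k := mul_le_mul_of_nonneg_right hSk hs0.le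
        _ = k := hsk
    have h2 : |C| * (1 + Real.log (1 + M)) ≤ |C| * (1 + Real.log (1 + M)) * Real.sqrt k :=
      le_mul_of_one_le_right hCM hs1
    have e : S * Real.sqrt k = 4 * |C| * Real.sqrt k + Real.sqrt k +
        |C| * (1 + Real.log (1 + M)) * Real.sqrt k := by rw [hS]; ring
    rw [e] at h1
    linarith
  linarith

/-- **The unbounded rung `g = log(1 + log ·)` through the socket**: the graded measure
`exp(−κ · L · log(1 + log L))` — in `(D, h)`-terms `exp(−κ · D log H · log log (D log H))`, strictly
weaker than the sum form and astronomically stronger than what is proved (`g = L`) — already decides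
the named cell.  So the (ε) booking may name ANY rung `g = o(log L / log log L)` as sufficient; this
one is certified. -/
theorem liouvilleNumber_sq_cell_of_graded_loglog
    (hG : GradedExpPairMeasure (fun L => Real.log (1 + Real.log L))) {b : ℕ} (hb : 2 ≤ b) :
    SB 2 ![((liouvilleNumber b : ℝ) : ℂ), ((liouvilleNumber b : ℝ) : ℂ) ^ 2] := by
  refine liouvilleNumber_sq_cell_of_graded hG ?_ ?_ hb (growth_loglog hb)
  · intro L hL
    exact Real.log_nonneg (by linarith [Real.log_nonneg hL])
  · intro L L' hL hLL'
    have h0 : 0 ≤ Real.log L := Real.log_nonneg hL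
    exact Real.log_le_log (by linarith) (by linarith [Real.log_le_log (by linarith) hLL'])

/-- **Ladder summary on the graded axis at `ℓ_b`** (what the kernel CONSUMES, by rung):
`g = 1` (sum form, §5) ⊂ `g` bounded (§8) ⊂ `g = log(1 + log L)` (this §) ⊂ any `g` with the
inverse-factorial growth condition (the socket) — each decides `SB 2 (ℓ_b, ℓ_b²)`; versus the PROVED
rung `g = L` (NW96 product form, tree Generic17/18), which reaches only the log-square classes and
NOT `ℓ_b` (Generic21).  The gap `log(1 + log L) ≪ g ≪ L` is exactly the open door (T⁺⁺). -/
theorem namedCell_socket_summary {b : ℕ} (hb : 2 ≤ b) :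
    (SumFormExpPairMeasure →
      SB 2 ![((liouvilleNumber b : ℝ) : ℂ), ((liouvilleNumber b : ℝ) : ℂ) ^ 2]) ∧
    (GradedExpPairMeasure (fun L => Real.log (1 + Real.log L)) →
      SB 2 ![((liouvilleNumber b : ℝ) : ℂ), ((liouvilleNumber b : ℝ) : ℂ) ^ 2]) ∧
    (∀ g : ℝ → ℝ, (∀ L, 1 ≤ L → 0 ≤ g L) → (∀ L L', 1 ≤ L → L ≤ L' → g L ≤ g L') →
      (∀ C c : ℝ, 0 < c → ∀ k₀ : ℕ, ∃ k : ℕ, k₀ ≤ k ∧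
        C * (1 + g (1 + c * ((k.factorial : ℝ) * Real.log b))) ≤ k) →
      GradedExpPairMeasure g →
      SB 2 ![((liouvilleNumber b : ℝ) : ℂ), ((liouvilleNumber b : ℝ) : ℂ) ^ 2]) ∧
    (NesterenkoWaldschmidt1996_thm_1 →
      GradedExpPairMeasure id) :=
  ⟨fun h => liouvilleNumber_sq_cell_of_sumForm h hb,
   fun h => liouvilleNumber_sq_cell_of_graded_loglog h hb,
   fun _ h0 hm hgr hG => liouvilleNumber_sq_cell_of_graded hG h0 hm hb hgr,
   (namedCell_axis hb).1⟩

end Summit.Schanuel.Schanuel.Theorems.RootDecomp1KSumFormBridge
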